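import Summits.SmoothPoincare4.SmoothPoincare4.Theses.SymplecticOrigami
import Summits.SmoothPoincare4.SmoothPoincare4.Theorems.OrigamiFoldExistence.Negative.ZeroSlack
import Summits.SmoothPoincare4.SmoothPoincare4.Theorems.SymplecticOrigamiOrigamiFoldExistenceStubChartEmbedding
import Summits.SmoothPoincare4.SmoothPoincare4.Theorems.SymplecticOrigamiOrigamiFoldExistenceStubReembedAlongDiffeo
import Summits.SmoothPoincare4.SmoothPoincare4.Theorems.SymplecticOrigamiOrigamiFoldExistenceStubSeamShell
import Summits.SmoothPoincare4.SmoothPoincare4.Theorems.SymplecticOrigamiOrigamiFoldExistenceStableSeamHostV2Reduction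
import Summits.SmoothPoincare4.SmoothPoincare4.Theorems.SymplecticOrigamiOrigamiFoldExistenceHelperHostEmbeddingOfGluckTwist
import Summits.SmoothPoincare4.SmoothPoincare4.Theorems.SymplecticOrigamiOrigamiFoldExistenceHelperDissolvableGluckLinks
import Summits.SmoothPoincare4.SmoothPoincare4.Theorems.SymplecticOrigamiOrigamiFoldExistenceHelperStableDisc
import Summits.SmoothPoincare4.SmoothPoincare4.Theorems.SymplecticOrigamiOrigamiFoldExistenceHelperStableSeamHypothesesInhabited
import Summits.SmoothPoincare4.SmoothPoincare4.Theorems.SymplecticOrigamiOrigamiFoldExistenceHelperStableSeamOfSmoothPoincare4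
import Summits.SmoothPoincare4.SmoothPoincare4.Theorems.SymplecticOrigamiOrigamiFoldExistenceHelperRoundSeamRigidity
import Summits.SmoothPoincare4.SmoothPoincare4.Theorems.SymplecticOrigamiOrigamiFoldExistenceHelperRoundTraceStable
import Summits.SmoothPoincare4.SmoothPoincare4.Theorems.SymplecticOrigamiOrigamiFoldExistenceHelperRoundSeamRigidityOuter
import Literature.Topology.FourManifolds.HomotopySpheres
import Literature.Topology.FourManifolds.HomotopyS4CompactProofs
import Literature.Topology.FourManifolds.HomotopyS4OrientableProofs
import Literature.Topology.FourManifolds.GluckTwist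
import Literature.Geometry.Kaehler.ComplexProjectiveSpaceFubiniStudy

/-!
# Skeleton line `stable-seam-host` for crux `OrigamiFoldExistence` (stmt-SmoothPoincare4-7844) — registry v3 (lead c11)

LEAD c11 STATUS (2026-08-17, continuation; this file = registry v3, RESHAPED from c10's v2 in ONE place):
* WHY.  Of v2's three open stubs, STUB 1 and STUB 3 are SPC4-SHIELDED in the kernel (p154209) but SR
  (`stub_stableRepresentative`: EVERY shell-embedded `S³` in EVERY rational host has a stable
  representative in its `Diff(X)`-orbit) is NOT implied by SPC4: at seams whose `b⁺ = 0` side is an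
  exotic definite piece, or whose exceptional configuration is smoothly-but-not-symplectically
  standard, SR asks for MIXED stable 3-spheres (CALIBRATION-c10 §3.2–3.3) — flexible stable
  Hamiltonian topology independent of the crux.  The line USES SR only at seams `J ∘ e` of fake
  balls.  v3 therefore registers SR-AS-USED — `stub_stableSeam` (= v1's STUB 2 over the v2 host:
  some re-embedding `J'` of the fake-ball neighbourhood has a stabilised seam) — in place of SR, and
  keeps SR as the documented exotica-free SUFFICIENT statement (`stableSeam_of : SR ∧ transport ⇒
  StableSeam`, proved below; the transport stubs are LANDED, p154047/p154126).  With the lead's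
  cycle-1 LANDING `helper_stableSeamV2_of_smoothPoincare4 : SmoothPoincare4 → StableSeam` (p162106;
  bricks p160631/p160722/p160852 — Palais'
  ball-complement theorem transported along `S ≅ S⁴` = a disc parametrising the fake ball WITH THE
  BOUNDARY VALUES OF `e`; thinning by `ballStretch`; c10's known rung of SR at discs p157795;
  transfer of the stability clauses between shell maps agreeing ON the sphere only — tangential
  congruence), EVERY registered stub is SPC4-implied and the three together imply SPC4, both in the
  kernel (`helper_smoothPoincare4_iff_stableSeamHostV3`): registry v3 is an EXACT three-way split of
  the crux, verbatim the strategist's children.json (HostEmbedding ∧ StableSeam ∧ StableSeamRigidity,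
  Lines/split-stable-seam-host.md) at the v2 host, its `--glue-by` being the landed
  `helper_origamiFoldExistence_of_stableSeamHostV3`.
* STUBS v3 (3 registered, all research-open, none misstated, none idle): `stub_hostEmbedding`
  (dissolution into a rational host; ⇐ StabOneSuffices stmt-0386, ⇐ DissolveOne stmt-17710, PROVED
  for Gluck twists), `stub_stableSeam` (SR-as-used; ⇐ SR; ⇐ SPC4), `stub_stableSeamRigidity`
  (stable-seam rigidity = FEF + SHS; ⇐ SPC4).  Composition `OrigamiFoldExistence_of` unchanged in
  shape (host ⟶ stable seam ⟶ rigidity ⟶ transport of the round fold data).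
* CYCLE 2 (c11): THE ROUND-SEAM RUNG OF STUB 3 IS A KERNEL THEOREM MODULO stmt-11009 —
  `helper_roundSeamRigidity_of_gromovRecognitionRelEnd` (p163844): `GromovRecognitionRelEnd →` [STUB 3
  with the stabilising form replaced by a ROUND seam GERM in the chart `e`: `(J ∘ e)^*Ω =
  κ²(A ∘ ι)^*ω_std` on an annulus] `→ S ≅ S⁴` (coordinate at infinity `κ•A∘ι∘e⁻¹` p163628, glued
  symplectic form on the punctured sphere p163639 via generic closed-form gluing p163243, Gromov's
  recognition rel. the end BY NAME, untwisted-double endgame p163337 — Cerf-free; non-vacuity of the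
  whole package at `S⁴ ⊂ S² × S²` p163435), with the rider `helper_smoothPoincare4_of_hostEmbedding_roundSeam :
  GromovRecognitionRelEnd → HostEmbedding → RoundSeam → SmoothPoincare4` (`RoundSeam` below).  Ladder for
  STUB 3, bottom to top: ROUND GERM (kernel, ⇐ stmt-11009) ⊂ ROUND TRACE (McDuff 1990 Thm 1.7, p = 1;
  + Liouville collar, L–XL formal, no contact-type collar normal form in the tree) ⊂ CONTACT-TYPE TRACE
  (+ Eliashberg tight `S³` = named fact `eliashberg_contactRepresentative_sphere_three`, undischarged, +
  Gray, PROVED in tree) ⊂ STABLE TRACE (STUB 3 proper, research).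
* CYCLE 3 (c11): ROUND ⊂ STABLE BY NAME — `helper_stableSeam_of_roundSeam : RoundSeam → StableSeam`
  (p164763, via `helper_isStabilising_of_roundTrace`: a round seam trace is stabilised by the transported
  Liouville form `u ↦ ½ ω_std(A u, A ·)`); so the rung hypothesis implies the registered STUB 2, and under
  `GromovRecognitionRelEnd` the round case of the whole v3 composition closes end-to-end.
  Also the round-seam rung with the NATURAL ONE-SIDED germ hypothesis (round on the outer collar
  `e({1 < ‖y‖ < 1 + δ})` only, i.e. just inside the fake ball): `helper_roundSeamRigidity_outer_of_gromovRecognitionRelEnd`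
  (p164872; reduces to p163844 by rescaling the chart ball, `Dι_{cy}(cv) = c⁻¹Dι_y(v)`).

LEAD c10 STATUS (2026-08-17, continuation; this file = registry v2, RESHAPED from c8/c9's v1 —
v1 kept verbatim in the seat folder as `work/OrigamiFoldExistence_v1_c9.lean`):
* WHY A RESHAPE.  v1 ended fully calibrated (CALIBRATION-c8/c9): STUB 1 kernel-placed
  ⇐ `Stabilisation.StabOneSuffices` (p147741), STUB 2 and STUB 3 promoted as crux-sized with no
  kernel work left below research size EXCEPT two items c9 named and left undone, which v2 does:
  (1) HOST WIDENED TO ADMIT `ℂℙ²`: the uniruledness clause "square-zero symplectic sphere pair"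
  (`UniruledWitness`) becomes `IsRationalHost` := square-zero pair ∨ `(X, Ω) ≅ (ℂℙ², a·ω_FS)`
  (Gromov 1985: lines through every point for every tame `J` — the original uniruling; McDuff 1990
  Thm 1.3 covers both disjuncts).  With it the card's "STUB 1 is KNOWN for every Gluck twist" becomes
  PROVABLE IN THE KERNEL from the tree's discharged `gluckTwist_connectedSum_complexProjectivePlane_holds`
  (`Σ_K # ℂℙ² ≅ ℂℙ²`), the tree's Fubini–Study form `CPn.fsForm 2` (symplectic, proved) and c9's
  `IsConnectedSum` glue pattern — lead's target `helper_hostEmbedding_of_isGluckTwist`, with the rider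
  "`StableRepresentative ∧ StableSeamRigidity` ⇒ every Gluck twist is standard": the Gluck problem
  reduced in the kernel to two statements about STABLE 3-SPHERES IN RATIONAL SURFACES.
  (2) STUB 2 SPLIT 1:1 with the strategist's birth skeleton `Lines/split_StableSeam_birth.lean`:
  `StableSeam ⇐ StableRepresentative ∧ ReembedAlongDiffeo ∧ SeamShell` (proved below,
  `stableSeam_of`), the first = SR for 3-spheres in rational hosts (the exotica-free research statement
  c9 recommended filing: Cardona 2023 p. 5, Cardona–Gironella 2025 p. 2 — "not addressed"), the other
  two formal transport (M each).  STUB 1 and STUB 3 keep their NAMES with the v2 host.  5 stubs ≤ 7.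
* SHIELDS TRANSFER by `Or.inl`: SPC4 ⇒ STUB 1 v2 (from p147740), SPC4 ⇒ STUB 3 v2 (conclusion is
  the diffeomorphism), StabOneSuffices ⇒ STUB 1 v2 (from p147741) — wave-1 adapters.  `ℂℙ²`-hosts do
  not trivialise STUB 3 (fake ball `W ⊂ ℂℙ²` with `ω_FS`-stable seam: `b⁺(ℂℙ² ∖ W) = 1`, so c9's
  two-sided sign theorem holds verbatim — every witness of an exotic `S` is a MIXED stable sphere;
  known rung = contact-type seam, McDuff 1990 Thm 1.7) and SR in a rational host is not refutable
  short of new exotica (every separating `S³` in a closed symplectic 4-manifold has a `b⁺ = 0` side by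
  Taubes–SW; in `ℂℙ²` and `S² × S²` the lattice forces a homology-ball side).

* CYCLE 2 (c10): SR's KNOWN RUNG IS A KERNEL THEOREM — `helper_stableRepresentative_of_disc`
  (p157795): in ANY symplectic `ℝ⁴`-charted connected `(X, Ω)`, for every disc `G : ℝ⁴ → X` there
  are `φ : X ≅ X` and `θ` with `IsStabilising (shellTrace X Ω (φ ∘ G)) θ` — SR holds at every seam that
  bounds a smoothly embedded ball (so SPC4 shields the line's USE of SR on paper: a fake ball is then a
  ball).  Chain: `Literature/Geometry/Symplectic/ContactTypeSmallSpheres.lean` (p157035: small spheres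
  of a symplectic chart are stabilised/contact type — rescaled cone primitive, exact Poincaré lemma,
  Pfaffian perturbation; bricks p156318 PoincareLemmaOneJet, p156187 PfaffianWedgeFour, p156415
  WedgeBracketFour), `helper_inChart_symplectic_package` (p155829), stability-clause invariances
  (p156001), `helper_exists_stable_disc` + unoriented disc theorem (p157795).  NON-VACUITY of STUB 3's
  hypothesis package at `S⁴` in the host `S² × S²`: `helper_stableSeamHypotheses_inhabited` (p157433;
  Archimedes map p155661, Darboux polydisc p156433, antipodal chart pair p156659).

LEAD c8 STATUS (2026-08-17, cycle 1; details `CALIBRATION-c8.md`):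
* landed `--supports`: `Theorems/SymplecticOrigamiOrigamiFoldExistenceStableSeamHostReduction.lean` (p141078:
  the three v1 stubs ⇒ `SmoothPoincare4` ⇒ the crux BY NAME; shield SPC4 ⇒ STUB 3 v1),
  `…HelperIsStabilisingRoundContactSphere.lean` (p141283), `helper_seamTrace_rank` (p141486).
* STUB 3 (hardest) CALIBRATED — Wendl's sweep-out recogniser transfers to stable Hamiltonian ends;
  residue = FEF(seam SHS), research-sized.  Verdict: `promote-stub stub_stableSeamRigidity`.

LEAD c9 STATUS (2026-08-17; details `CALIBRATION-c9.md`, `CALIBRATION-c9-STUB1/2-report.md`):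
* STUB 1 KERNEL-PLACED: `helper_hostEmbedding_of_stabOneSuffices : StabOneSuffices → stub_hostEmbedding` (v1,
  p147741), shield `SmoothPoincare4 → stub_hostEmbedding` (v1, p147740), host package `S² × S²` on `ℝ⁴`
  (p143290/p144665/p145989, `helper_hostPackage_sphereProd` p147739).
* STUB 2 CALIBRATED: content for an exotic `S` = SR-seam, ABSENT from print, asked as OPEN in density
  form; two-sided sign theorem (`f ≥ 0` forces the ball, `f ≤ 0` impossible in a closed host).  Verdict:
  `promote-stub stub_stableSeam`; file SR as a conjecture item.
* STUB 3: c8's F4 application to the CV seam RETRACTED (no equivariant positive FEF on any CV seam);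
  FEF(∂B_CV) OPEN with non-equivariant leaves.

Route `SymplecticOrigami`, crux r4 `OrigamiFoldExistence` (E; zero slack modulo R, D, RS:
`Negative.ZeroSlackSharp`).  Registered by the crux-strategist (wall-breaker, generation 1,
2026-08-17) after the opening chain exhausted (lines `round-trace-continuity`, `shadow-pleats`,
`bennequin-defect-certificates` dead; see `STRATEGY-CENSUS.md` of this crux).  Card:
`Lines/stable-seam-host.md`.

THE LINE (one paragraph).  E(Σ) ⟺ the fake ball `Δ = Σ ∖ e(B̊⁴)` is a ball ⟺ (Negative.ZeroSlack)
SPC4(Σ).  Every dead line tried to NORMALISE an object attached to Δ (a crease, a pleated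
embedding, a Kirby diagram) until a recogniser in print applies, and died at the normalisation
step (PATH, S3'', Legendrian normal form).  This line changes the recogniser instead of the
normal form: put Δ inside a CLOSED, SIMPLY CONNECTED, UNIRULED symplectic 4-manifold `(X, Ω)`
(a "rational host": a square-zero symplectic sphere pair, or `ℂℙ²` with its lines; smooth
statement, STUB 1) so that the seam `Y = ∂Δ ≅ S³` is an Ω-STABLE hypersurface (Hofer–Zehnder /
Cieliebak–Volkov: the Hamiltonian structure `Ω|_Y` admits a stabilising 1-form; STUB 2 =
SR ∧ transport), and recognise the ball by NECK-STRETCHING the host's GW-spheres along the stable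
seam (STUB 3: "stable 3-spheres in rational symplectic 4-manifolds bound balls on their
homologically trivial side" — the stable Hamiltonian generalisation of the theorem of
Gromov–Eliashberg–McDuff for CONTACT-TYPE 3-spheres, which is the known rung).  Stability is
EXACTLY the hypothesis under which holomorphic curves have SFT compactness along `Y` (BEHWZ 2003),
the stabilising form is free for the filling (the collar germ depends on `Ω|_Y` only), and
`π₁(Σ) = 1` is consumed STRUCTURALLY: a codimension-0 piece with `S³` boundary of a simply
connected closed 4-manifold is simply connected (van Kampen), so Kervaire's homology balls
(Disproof §7b) never occur as `J(Δ)` — the Kervaire test is passed by the type of STUB 1/3, not by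
a scope stub.

STUBS (5, all registered; composition `OrigamiFoldExistence_of` kernel-checked, sorries only in
`stub_*`):
* `stub_hostEmbedding` [STUB 1 v2, smooth topology, "dissolution into a rational host"]: for every
  homotopy 4-sphere `S` and chart ball `e`, a neighbourhood of the fake ball `Δ_e` smoothly embeds
  (`J`) into some closed simply connected symplectic `(X, Ω)` which is a RATIONAL HOST
  (`IsRationalHost`: square-zero symplectic sphere pair, or `(X, Ω) ≅ (ℂℙ², a·ω_FS)`).
  ⇐ `StabOneSuffices` (kernel, c9 + adapter) and ⇐ `ℂℙ²`-dissolution (kernel, c10: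
  `helper_hostEmbedding_of_connectedSum_complexProjectivePlane`), hence PROVED for every Gluck twist
  (`helper_hostEmbedding_of_isGluckTwist`).
* `stub_stableRepresentative` [SR, flexible stable Hamiltonian topology, exotica-free, OPEN]: in a
  closed simply connected rational host every shell embedding `g` of `S³` is moved by a
  self-diffeomorphism `φ` of `X` to one with STABILISABLE trace.
* `stub_reembedAlongDiffeo` [transport, formal M]: `EmbedsFakeBallNhd` is preserved by
  post-composition with a diffeomorphism `X ≅ Y`.
* `stub_seamShell` [transport, formal M]: for a chart ball `e` and a fake-ball-neighbourhood
  embedding `J`, `J ∘ e` is a shell embedding of `S³`.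
* `stub_stableSeamRigidity` [STUB 3 v2, rigid: holomorphic curves, HARDEST, load-bearing]: a homotopy
  4-sphere whose fake ball sits in a rational host with stable seam is diffeomorphic to `S⁴`
  (Cerf `Γ₄ = 0` internal).  Known rung: contact-type seam.  Bench: the Cieliebak–Volkov exotic
  ball (CV 2015 Prop 7.15 / Cor 7.17).  Residue: FEF + T7-SHS (CALIBRATION-c8/c9).

Composition: `stub_chartEmbedding` (LANDED p87331) gives `e`; STUB 1 the host `(X, Ω, J)`;
`stub_seamShell` makes `J ∘ e` a shell embedding; SR gives `φ, θ`; `stub_reembedAlongDiffeo` makes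
`φ ∘ J` a fake-ball-neighbourhood embedding whose seam trace IS the stabilised one
(`seamTrace S e X Ω (φ ∘ J) = shellTrace X Ω (φ ∘ (J ∘ e))` definitionally); STUB 3 gives
`S ≅ S⁴`; the PROVED packaging facts and transport with the CLOSED route item
`RoundSphereIsOrigamiFold` (stmt-7845) give E.

Disproof used (Disproof.lean v6.1, unchanged since 2026-08-16T05:59Z, re-read by c10; no
`-- Targets` on this line): §1.1 `crux_false_without_homotopyEquiv` and §7b honoured BY TYPE;
§2 zero slack conceded and LOCATED (SR ∧ STUB 3 carry SPC4 modulo STUB 1); §9.1 is the model for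
the line's own tightness statement "STUB 3 is not a statement about traces" (CV Cor 7.17); no
landed `Negative/` lemma concerns hypersurfaces in closed symplectic hosts; `ledger negatives`: 0.
-/

noncomputable section

-- the prescribed namespace `Summit.<P>.<Sub>.…` duplicates `SmoothPoincare4` (P = Sub)
set_option linter.dupNamespace false

open scoped Manifold ContDiff Topology RealInnerProductSpace
open Set Function TopologicalSpace ContinuousMap
open Literature.Topology.FourManifolds (HomotopySphere ComplexProjectivePlane TwoKnot IsGluckTwist)
open Summit.SmoothPoincare4.SmoothPoincare4.Theses.SymplecticOrigami (OrigamiFoldExistence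
  RoundSphereIsOrigamiFold)

namespace Summit.SmoothPoincare4.SmoothPoincare4.Cruxes.OrigamiFoldExistence.StableSeamHost

/-- Local notation: the model space `ℝ⁴`. -/
local notation "E4" => EuclideanSpace ℝ (Fin 4)

/-- Local notation: the round 4-sphere with Mathlib's smooth structure. -/
local notation "𝕊⁴" => (Metric.sphere (0 : EuclideanSpace ℝ (Fin 5)) 1)

/-- Local notation: the round 2-sphere (domain of the uniruledness witness). -/
local notation "𝕊²" => (Metric.sphere (0 : EuclideanSpace ℝ (Fin 3)) 1)

/-! ### Vocabulary (plain definitions over Mathlib and the tree's `MForm`; no new objects are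
posited; every registered signature below INLINES these, as the gate matches `--supports` files
against the registry textually) -/

/-- `Ω` is a SYMPLECTIC FORM on the `ℝ⁴`-charted manifold `X`: a chartwise-smooth, closed,
pointwise nondegenerate 2-form (the route's convention, items D/R/E). -/
def IsSymplecticForm (X : Type) [TopologicalSpace X] [ChartedSpace E4 X]
    (Ω : Literature.Geometry.Kaehler.MForm (𝓡 4) X ℝ 2) : Prop :=
  Literature.Geometry.Kaehler.IsSmoothForm Ω ∧ Literature.Geometry.Kaehler.IsClosedForm Ω ∧
    ∀ x (v : TangentSpace (𝓡 4) x), v ≠ 0 → ∃ w, Ω x ![v, w] ≠ 0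

/-- `J : S → X` EMBEDS A NEIGHBOURHOOD OF THE FAKE BALL `Δ_e = S ∖ e(B̊⁴)` of the homotopy 4-sphere
`S` cut out by the chart ball `e`: on some open `U ⊇ Δ_e`, `J` is `C^∞`, injective and immersive
(an injective immersion of an open set containing the compact `Δ_e` restricts to a smooth
embedding of a smaller neighbourhood; `J(e(S³))` is the SEAM, a smooth separating 3-sphere of `X`
bounding `J(Δ_e)`). -/
def EmbedsFakeBallNhd (S : HomotopySphere 4) (e : E4 → S.carrier) (X : Type) [TopologicalSpace X]
    [ChartedSpace E4 X] (J : S.carrier → X) : Prop :=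
  ∃ U : Set S.carrier, IsOpen U ∧ (e '' Metric.ball (0 : E4) 1)ᶜ ⊆ U ∧
    ContMDiffOn (𝓡 4) (𝓡 4) ∞ J U ∧ Set.InjOn J U ∧
      ∀ x ∈ U, Function.Bijective (mfderiv (𝓡 4) (𝓡 4) J x)

/-- `g : ℝ⁴ → X` is a SHELL EMBEDDING of the unit sphere `S³ ⊂ ℝ⁴`: `C^∞`, injective and
immersive on an open `V ⊇ S³` (so `g(S³)` is a smoothly embedded 3-sphere of `X` with a
bicollar).  The seam `J ∘ e` of a fake-ball-neighbourhood embedding is one (`stub_seamShell`). -/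
def IsShellEmbedding (X : Type) [TopologicalSpace X] [ChartedSpace E4 X] (g : E4 → X) : Prop :=
  ∃ V : Set E4, IsOpen V ∧ Metric.sphere (0 : E4) 1 ⊆ V ∧
    ContMDiffOn (𝓡 4) (𝓡 4) ∞ g V ∧ Set.InjOn g V ∧
      ∀ u ∈ V, Function.Bijective (mfderiv (𝓡 4) (𝓡 4) g u)

/-- The TRACE of `Ω` along a shell map `g : ℝ⁴ → X`, written on `ℝ⁴`:
`σ_u(v, w) = Ω_{g u}(Dg_u v, Dg_u w)`; only its values for `‖u‖ = 1`, `v, w ⊥ u` are used. -/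
def shellTrace (X : Type) [TopologicalSpace X] [ChartedSpace E4 X]
    (Ω : Literature.Geometry.Kaehler.MForm (𝓡 4) X ℝ 2) (g : E4 → X) : E4 → E4 → E4 → ℝ :=
  fun u v w => Ω (g u) ![mfderiv (𝓡 4) (𝓡 4) g u v, mfderiv (𝓡 4) (𝓡 4) g u w]

/-- The SEAM TRACE in the chart: the Hamiltonian structure `σ = (J ∘ e)|_{S³}^* Ω` written on
`ℝ⁴` — the shell trace of `J ∘ e` (definitionally). -/
def seamTrace (S : HomotopySphere 4) (e : E4 → S.carrier) (X : Type) [TopologicalSpace X]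
    [ChartedSpace E4 X] (Ω : Literature.Geometry.Kaehler.MForm (𝓡 4) X ℝ 2)
    (J : S.carrier → X) : E4 → E4 → E4 → ℝ :=
  shellTrace X Ω (J ∘ e)

/-- `θ` STABILISES the Hamiltonian structure `σ` on the unit sphere `S³ ⊂ ℝ⁴` (Cieliebak–Volkov,
JEMS 17 (2015), Definition on p. 2, written orientation-free): `θ` is a smooth 1-form on `ℝ⁴`
(only `θ|_{TS³}` matters) with (i) `θ ∧ σ` NOWHERE ZERO on `TS³` — evaluated on every linearly
independent tangent triple `v ⊥ u` — and (ii) `ker σ ⊂ ker dθ` on `TS³`, with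
`dθ_u(v, w) = (D_v θ)(w) − (D_w θ)(v)`.  Equivalently (HZ 1994, CV 2015 §2): the seam is a STABLE
HYPERSURFACE (tubular neighbourhood `(-ε, ε) × S³` with the form `σ + d(tθ)`), the hypothesis of
SFT compactness (BEHWZ 2003). -/
def IsStabilising (σ : E4 → E4 → E4 → ℝ) (θ : E4 → E4 →L[ℝ] ℝ) : Prop :=
  ContDiff ℝ ∞ θ ∧
    (∀ u : E4, ‖u‖ = 1 → ∀ v : Fin 3 → E4, (∀ i, ⟪v i, u⟫ = 0) → LinearIndependent ℝ v →
      θ u (v 0) * σ u (v 1) (v 2) - θ u (v 1) * σ u (v 0) (v 2) + θ u (v 2) * σ u (v 0) (v 1) ≠ 0) ∧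
    (∀ u : E4, ‖u‖ = 1 → ∀ v : E4, ⟪v, u⟫ = 0 → (∀ w : E4, ⟪w, u⟫ = 0 → σ u v w = 0) →
      ∀ w : E4, ⟪w, u⟫ = 0 → fderiv ℝ θ u v w - fderiv ℝ θ u w v = 0)

/-- UNIRULEDNESS WITNESS (square-zero kind): an Ω-symplectic smoothly embedded 2-sphere `c` with a
DISJOINT homotopic smoothly embedded push-off `c'` — hence `[c]² = 0`, `(X, Ω)` is (a blow-up of)
a ruled surface by McDuff 1990 Thm 1.3, rational when `X` is simply connected, and for EVERY tame
`J` an embedded `J`-sphere in the class `[c]` passes through every point. -/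
def UniruledWitness (X : Type) [TopologicalSpace X] [ChartedSpace E4 X]
    (Ω : Literature.Geometry.Kaehler.MForm (𝓡 4) X ℝ 2) (c c' : 𝕊² → X) : Prop :=
  Manifold.IsSmoothEmbedding (𝓡 2) (𝓡 4) ∞ c ∧
    (∀ y (v : TangentSpace (𝓡 2) y), v ≠ 0 →
      ∃ w : TangentSpace (𝓡 2) y, Ω (c y) ![mfderiv (𝓡 2) (𝓡 4) c y v, mfderiv (𝓡 2) (𝓡 4) c y w] ≠ 0) ∧
    Manifold.IsSmoothEmbedding (𝓡 2) (𝓡 4) ∞ c' ∧ Disjoint (Set.range c) (Set.range c') ∧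
    ∃ H : unitInterval × 𝕊² → X, Continuous H ∧ ∀ y, H (0, y) = c y ∧ H (1, y) = c' y

/-- RATIONAL HOST (v2): `(X, Ω)` carries a square-zero uniruledness witness, OR `(X, Ω)` is the
complex projective plane with a positive multiple of the tree's Fubini–Study form
(`Literature.Geometry.Kaehler.CPn.fsForm 2`, symplectic: `CPn.isSmoothForm_fsForm`,
`CPn.isClosedForm_fsForm`, `CPn.fsForm_nondegenerate`) transported along a diffeomorphism
`Ψ : X ≅ ℂℙ²` — uniruled by LINES (Gromov 1985: for every tame `J` a `J`-line through every
point).  McDuff 1990 Thm 1.3: either way `(X, Ω)` is rational or ruled (up to blow-up); with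
`π₁ = 1`, a rational surface.  The second disjunct is what the tree's discharged Gluck-twist
dissolution `Σ_K # ℂℙ² ≅ ℂℙ²` feeds. -/
def IsRationalHost (X : Type) [TopologicalSpace X] [ChartedSpace E4 X]
    (Ω : Literature.Geometry.Kaehler.MForm (𝓡 4) X ℝ 2) : Prop :=
  (∃ c c' : 𝕊² → X, UniruledWitness X Ω c c') ∨
    ∃ (Ψ : X ≃ₘ⟮𝓡 4, 𝓡 4⟯ ComplexProjectivePlane) (a : ℝ), 0 < a ∧
      ∀ x (v w : TangentSpace (𝓡 4) x), Ω x ![v, w] =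
        a * Literature.Geometry.Kaehler.CPn.fsForm 2 (Ψ x)
          ![mfderiv (𝓡 4) (𝓡 4) Ψ x v, mfderiv (𝓡 4) (𝓡 4) Ψ x w]

/-- The FOLD DATA of the crux on a manifold `M` with the summit's binders — VERBATIM the matrix of
`OrigamiFoldExistence` (so `OrigamiFoldExistence = ∀ M …, M ≃ₕ S⁴ → FoldData M` and
`RoundSphereIsOrigamiFold = FoldData S⁴` definitionally). -/
def FoldData (M : Type) [TopologicalSpace M] [T2Space M] [SecondCountableTopology M]
    [ChartedSpace (EuclideanSpace ℝ (Fin 4)) M] [IsManifold (𝓡 4) ∞ M] : Prop :=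
  ∃ (V : Fin 2 → TopologicalSpace.Opens M) (N : Fin 2 → Type) (_ : ∀ i, TopologicalSpace (N i)) (_ : ∀ i, T2Space (N i)) (_ : ∀ i, SecondCountableTopology (N i)) (_ : ∀ i, CompactSpace (N i)) (_ : ∀ i, ConnectedSpace (N i)) (_ : ∀ i, ChartedSpace (EuclideanSpace ℝ (Fin 4)) (N i)) (_ : ∀ i, IsManifold (𝓡 4) ∞ (N i)) (s : ∀ i, Literature.Geometry.Kaehler.MForm (𝓡 4) (N i) ℝ 2) (S : Fin 2 → Type) (_ : ∀ i, TopologicalSpace (S i)) (_ : ∀ i, CompactSpace (S i)) (_ : ∀ i, ConnectedSpace (S i)) (_ : ∀ i, ChartedSpace (EuclideanSpace ℝ (Fin 2)) (S i)) (_ : ∀ i, IsManifold (𝓡 2) ∞ (S i)) (b : ∀ i, S i → N i) (β : ∀ i, M → N i), (Disjoint (V 0) (V 1) ∧ (∀ i, (V i : Set M).Nonempty) ∧ IsConnected ((V 0 : Set M) ∪ (V 1 : Set M))ᶜ ∧ (∃ (Z : Type) (_ : TopologicalSpace Z) (_ : ChartedSpace (EuclideanSpace ℝ (Fin 3)) Z)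 (_ : IsManifold (𝓡 3) ∞ Z) (z : Z → M), Manifold.IsSmoothEmbedding (𝓡 3) (𝓡 4) ∞ z ∧ Set.range z = ((V 0 : Set M) ∪ (V 1 : Set M))ᶜ)) ∧ (∀ i, Literature.Geometry.Kaehler.IsSmoothForm (s i) ∧ Literature.Geometry.Kaehler.IsClosedForm (s i) ∧ (∀ x (v : TangentSpace (𝓡 4) x), v ≠ 0 → ∃ w, s i x ![v, w] ≠ 0) ∧ Manifold.IsSmoothEmbedding (𝓡 2) (𝓡 4) ∞ (b i) ∧ (∀ y (v : TangentSpace (𝓡 2) y), v ≠ 0 → ∃ w : TangentSpace (𝓡 2) y, s i (b i y) ![mfderiv (𝓡 2) (𝓡 4) (b i) y v, mfderiv (𝓡 2) (𝓡 4) (b i) y w] ≠ 0) ∧ (∃ U : Set M, IsOpen U ∧ closure (V i : Set M) ⊆ U ∧ ContMDiffOn (𝓡 4) (𝓡 4) ∞ (β i) U) ∧ Set.InjOn (β i) (V i : Set M) ∧ β i '' (V i : Set M) = (Set.range (b i))ᶜ ∧ (∀ x ∈ (V i : Set M), Function.Bijective (mfderiv (𝓡 4) (𝓡 4) (β i) x))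 ∧ β i '' frontier (V i : Set M) ⊆ Set.range (b i) ∧ (∀ x ∈ frontier (V i : Set M), Module.finrank ℝ (LinearMap.ker (mfderiv (𝓡 4) (𝓡 4) (β i) x).toLinearMap) = 1))

/-! ### The stub STATEMENTS (named `Prop`s; the registered `stub_*` theorems below restate them
with the vocabulary INLINED, and `Registered.stub_*` are their name-keyed aliases used as the
hypotheses of `OrigamiFoldExistence_of`) -/

/-- Statement of STUB 1 v2 [a rational host for the fake ball]. -/
def HostEmbedding : Prop :=
  ∀ (S : HomotopySphere 4) (e : E4 → S.carrier), Manifold.IsSmoothEmbedding (𝓡 4) (𝓡 4) ∞ e →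
    ∃ (X : Type) (_ : TopologicalSpace X) (_ : T2Space X) (_ : SecondCountableTopology X)
      (_ : CompactSpace X) (_ : ChartedSpace E4 X) (_ : IsManifold (𝓡 4) ∞ X)
      (_ : SimplyConnectedSpace X) (Ω : Literature.Geometry.Kaehler.MForm (𝓡 4) X ℝ 2)
      (J : S.carrier → X),
      IsSymplecticForm X Ω ∧ EmbedsFakeBallNhd S e X J ∧ IsRationalHost X Ω

/-- Statement of SR [stable representative for 3-spheres in rational hosts] — NOT a registered stub in
v3 (not SPC4-implied); the exotica-free SUFFICIENT condition for `StableSeam` (`stableSeam_of`). -/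
def StableRepresentative : Prop :=
  ∀ (X : Type) [TopologicalSpace X] [T2Space X] [SecondCountableTopology X] [CompactSpace X]
    [ChartedSpace E4 X] [IsManifold (𝓡 4) ∞ X] [SimplyConnectedSpace X]
    (Ω : Literature.Geometry.Kaehler.MForm (𝓡 4) X ℝ 2) (g : E4 → X),
    IsSymplecticForm X Ω → IsRationalHost X Ω → IsShellEmbedding X g →
    ∃ (φ : X ≃ₘ⟮𝓡 4, 𝓡 4⟯ X) (θ : E4 → E4 →L[ℝ] ℝ), IsStabilising (shellTrace X Ω (φ ∘ g)) θ

/-- Statement of the first transport stub [re-embedding along a host diffeomorphism `X ≅ Y`]. -/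
def ReembedAlongDiffeo : Prop :=
  ∀ (S : HomotopySphere 4) (e : E4 → S.carrier) (X : Type) [TopologicalSpace X]
    [ChartedSpace E4 X] [IsManifold (𝓡 4) ∞ X] (Y : Type) [TopologicalSpace Y]
    [ChartedSpace E4 Y] [IsManifold (𝓡 4) ∞ Y] (J : S.carrier → X) (φ : X ≃ₘ⟮𝓡 4, 𝓡 4⟯ Y),
    EmbedsFakeBallNhd S e X J → EmbedsFakeBallNhd S e Y (φ ∘ J)

/-- Statement of the second transport stub [the seam of a host embedding is a shell embedding]. -/
def SeamShell : Prop :=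
  ∀ (S : HomotopySphere 4) (e : E4 → S.carrier) (X : Type) [TopologicalSpace X]
    [ChartedSpace E4 X] [IsManifold (𝓡 4) ∞ X] (J : S.carrier → X),
    Manifold.IsSmoothEmbedding (𝓡 4) (𝓡 4) ∞ e → EmbedsFakeBallNhd S e X J →
    IsShellEmbedding X (J ∘ e)

/-- Statement of STUB 2 v3 = SR-AS-USED (v1's `stub_stableSeam` over the v2 host): the registered
stub; DERIVABLE from SR ∧ the two transport stubs (`stableSeam_of`) and implied by SPC4. -/
def StableSeam : Prop :=
  ∀ (S : HomotopySphere 4) (e : E4 → S.carrier) (X : Type) [TopologicalSpace X] [T2Space X]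
    [SecondCountableTopology X] [CompactSpace X] [ChartedSpace E4 X] [IsManifold (𝓡 4) ∞ X]
    [SimplyConnectedSpace X] (Ω : Literature.Geometry.Kaehler.MForm (𝓡 4) X ℝ 2)
    (J : S.carrier → X),
    Manifold.IsSmoothEmbedding (𝓡 4) (𝓡 4) ∞ e → IsSymplecticForm X Ω → EmbedsFakeBallNhd S e X J →
    IsRationalHost X Ω →
    ∃ (J' : S.carrier → X) (θ : E4 → E4 →L[ℝ] ℝ),
      EmbedsFakeBallNhd S e X J' ∧ IsStabilising (seamTrace S e X Ω J') θ

/-- Statement of STUB 3 v2 [stable seams in rational hosts bound balls ⇒ `S ≅ S⁴`]. -/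
def StableSeamRigidity : Prop :=
  ∀ (S : HomotopySphere 4) (e : E4 → S.carrier) (X : Type) [TopologicalSpace X] [T2Space X]
    [SecondCountableTopology X] [CompactSpace X] [ChartedSpace E4 X] [IsManifold (𝓡 4) ∞ X]
    [SimplyConnectedSpace X] (Ω : Literature.Geometry.Kaehler.MForm (𝓡 4) X ℝ 2)
    (J : S.carrier → X) (θ : E4 → E4 →L[ℝ] ℝ),
    Manifold.IsSmoothEmbedding (𝓡 4) (𝓡 4) ∞ e → IsSymplecticForm X Ω → EmbedsFakeBallNhd S e X J →
    IsRationalHost X Ω → IsStabilising (seamTrace S e X Ω J) θ →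
    Nonempty (S.carrier ≃ₘ⟮𝓡 4, 𝓡 4⟯ 𝕊⁴)

/-- Statement of the ROUND-SEAM rung hypothesis [`StableSeam` with "stabilised seam trace" replaced
by "round seam GERM": in the chart `e`, `(J' ∘ e)^*Ω = κ² (A ∘ ι)^*ω_std` on an annulus about the unit
sphere, `ι(z) = z/‖z‖²`].  SPC4-true on paper (Darboux chart + Palais' adapted disc + uniqueness of boundary collars; a kernel shield would need
Darboux's theorem, absent from the tree) — a RUNG below `StableSeam` (rider hypothesis), not a
registered stub of the composition. -/
def RoundSeam : Prop :=
  ∀ (S : HomotopySphere 4) (e : E4 → S.carrier) (X : Type) [TopologicalSpace X] [T2Space X]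
    [SecondCountableTopology X] [CompactSpace X] [ChartedSpace E4 X] [IsManifold (𝓡 4) ∞ X]
    [SimplyConnectedSpace X] (Ω : Literature.Geometry.Kaehler.MForm (𝓡 4) X ℝ 2)
    (J : S.carrier → X),
    Manifold.IsSmoothEmbedding (𝓡 4) (𝓡 4) ∞ e → IsSymplecticForm X Ω → EmbedsFakeBallNhd S e X J →
    IsRationalHost X Ω →
    ∃ (J' : S.carrier → X) (κ : ℝ) (A : E4 ≃ₗᵢ[ℝ] E4) (δ : ℝ), EmbedsFakeBallNhd S e X J' ∧ 0 < κ ∧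
      0 < δ ∧ ∀ y : E4, 1 - δ < ‖y‖ → ‖y‖ < 1 + δ → ∀ v w : E4, seamTrace S e X Ω J' y v w =
        κ ^ 2 * Literature.Geometry.Symplectic.stdSymplecticForm
          (A (fderiv ℝ Literature.Geometry.Symplectic.inversion y v))
          (A (fderiv ℝ Literature.Geometry.Symplectic.inversion y w))

/-- Statement [transport]: the typed fold data transport along a diffeomorphism (PROVED,
`Negative.foldData_transport`, p72874; not a stub). -/
def FoldDataTransport : Prop :=
  ∀ (M : Type) [TopologicalSpace M] [T2Space M] [SecondCountableTopology M]
    [ChartedSpace (EuclideanSpace ℝ (Fin 4)) M] [IsManifold (𝓡 4) ∞ M]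
    (M' : Type) [TopologicalSpace M'] [T2Space M'] [SecondCountableTopology M']
    [ChartedSpace (EuclideanSpace ℝ (Fin 4)) M'] [IsManifold (𝓡 4) ∞ M'],
    Nonempty (M ≃ₘ⟮𝓡 4, 𝓡 4⟯ M') → FoldData M' → FoldData M

/-! ### The registered stubs (vocabulary inlined; no local notation inside the statements) -/

/-- STUB 1 v2 [RATIONAL HOST] (smooth topology; open in general — "no homotopy 4-sphere is known
to dissolve in no rational surface", MMSW 2023 Q. 9.12 territory).  Every homotopy 4-sphere `S`,
cut open along a chart ball `e`, has its fake ball `Δ_e = S ∖ e(B̊⁴)` smoothly embedded — `J`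
injective, immersive and `C^∞` on an open `U ⊇ Δ_e` — in a CLOSED SIMPLY CONNECTED symplectic
`ℝ⁴`-charted `(X, Ω)` which is a rational host: it carries an `Ω`-symplectic embedded 2-sphere
with a disjoint homotopic push-off (square zero), OR it is `(ℂℙ², a·ω_FS)` up to the
diffeomorphism `Ψ`.  KERNEL: ⇐ `Stabilisation.StabOneSuffices` (c9, p147741, + `Or.inl`);
⇐ `ℂℙ²`-dissolution `Σ # ℂℙ² ≅ ℂℙ²` (c10); hence PROVED for every Gluck twist through the tree's
`gluckTwist_connectedSum_complexProjectivePlane_holds`.  Why it might fail: a homotopy sphere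
dissolving in NO rational surface (none known).  Sources: Wall1964, McDuff1990, AkbulutYasui2013,
KasprowskiPowellRay2023, ManolescuMarengonSarkarWillis2023, Gromov1985. -/
theorem stub_hostEmbedding :
    ∀ (S : Literature.Topology.FourManifolds.HomotopySphere 4) (e : EuclideanSpace ℝ (Fin 4) → S.carrier), Manifold.IsSmoothEmbedding (𝓡 4) (𝓡 4) ∞ e → ∃ (X : Type) (_ : TopologicalSpace X) (_ : T2Space X) (_ : SecondCountableTopology X) (_ : CompactSpace X) (_ : ChartedSpace (EuclideanSpace ℝ (Fin 4)) X) (_ : IsManifold (𝓡 4) ∞ X) (_ : SimplyConnectedSpace X) (Ω : Literature.Geometry.Kaehler.MForm (𝓡 4) X ℝ 2) (J : S.carrier → X), (Literature.Geometry.Kaehler.IsSmoothForm Ω ∧ Literature.Geometry.Kaehler.IsClosedForm Ω ∧ ∀ x (v : TangentSpace (𝓡 4) x), v ≠ 0 → ∃ w, Ω x ![v, w] ≠ 0) ∧ (∃ U : Set S.carrier, IsOpen U ∧ (e '' Metric.ball (0 : EuclideanSpace ℝ (Fin 4)) 1)ᶜ ⊆ U ∧ ContMDiffOn (𝓡 4)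 (𝓡 4) ∞ J U ∧ Set.InjOn J U ∧ ∀ x ∈ U, Function.Bijective (mfderiv (𝓡 4) (𝓡 4) J x)) ∧ ((∃ c c' : (Metric.sphere (0 : EuclideanSpace ℝ (Fin 3)) 1) → X, (Manifold.IsSmoothEmbedding (𝓡 2) (𝓡 4) ∞ c ∧ (∀ y (v : TangentSpace (𝓡 2) y), v ≠ 0 → ∃ w : TangentSpace (𝓡 2) y, Ω (c y) ![mfderiv (𝓡 2) (𝓡 4) c y v, mfderiv (𝓡 2) (𝓡 4) c y w] ≠ 0) ∧ Manifold.IsSmoothEmbedding (𝓡 2) (𝓡 4) ∞ c' ∧ Disjoint (Set.range c) (Set.range c') ∧ ∃ H : unitInterval × (Metric.sphere (0 : EuclideanSpace ℝ (Fin 3)) 1) → X, Continuous H ∧ ∀ y, H (0, y) = c y ∧ H (1, y) = c' y)) ∨ (∃ (Ψ : X ≃ₘ⟮𝓡 4, 𝓡 4⟯ Literature.Topology.FourManifolds.ComplexProjectivePlane) (a : ℝ), 0 < a ∧ ∀ x (v w : TangentSpace (𝓡 4) x), Ω x ![v, w] = a * Literature.Geometry.Kaehler.CPn.fsForm 2 (Ψ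 x) ![mfderiv (𝓡 4) (𝓡 4) Ψ x v, mfderiv (𝓡 4) (𝓡 4) Ψ x w])) := by
  sorry

/-- STUB 2 v3 = SR-AS-USED [A STABLE SEAM FOR THE FAKE BALL] (open; flexible stable Hamiltonian
topology at the seams the line produces).  For every homotopy 4-sphere `S`, chart ball `e`, closed
simply connected symplectic rational host `(X, Ω)` and fake-ball-neighbourhood embedding `J`, SOME
fake-ball-neighbourhood embedding `J'` (in the line: `φ ∘ J`, `φ ∈ Diff(X)`) has a STABILISABLE seam
trace `(J' ∘ e)|_{S³}^* Ω` (`θ ∧ σ ≠ 0` on `TS³`, `ker σ ⊂ ker dθ`).  KERNEL: ⇐ SR ∧ transport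
(`stableSeam_of`, transport LANDED p154047/p154126); ⇐ SPC4 (lead c11,
`helper_stableSeamV2_of_smoothPoincare4`: a fake ball that is a ball bounds a disc with the boundary
values of `e`, and discs have contact-type representatives, p157795).  Content for an exotic `S`: the
seam of a FAKE ball can only be a MIXED stable sphere (c9's two-sided sign theorem), and no
stable-representative / stable-approximation theorem for 3-spheres is in print (Cardona 2023
arXiv:2305.13158 p. 5; Cardona–Gironella 2025 arXiv:2407.01357 p. 2).  Why it might fail: a fake
ball all of whose re-embeddings have robustly non-stabilisable characteristic foliation on the seam
(Sullivan 1978) — only for an exotic `S`.  Sources: arXiv:2305.13158, arXiv:2407.01357,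
arXiv:1003.5084, HoferZehnder1994, EliashbergMishachev2009, Sullivan1978, McDuff1990, Palais1960. -/
theorem stub_stableSeam :
    ∀ (S : Literature.Topology.FourManifolds.HomotopySphere 4) (e : EuclideanSpace ℝ (Fin 4) → S.carrier) (X : Type) [TopologicalSpace X] [T2Space X] [SecondCountableTopology X] [CompactSpace X] [ChartedSpace (EuclideanSpace ℝ (Fin 4)) X] [IsManifold (𝓡 4) ∞ X] [SimplyConnectedSpace X] (Ω : Literature.Geometry.Kaehler.MForm (𝓡 4) X ℝ 2) (J : S.carrier → X), Manifold.IsSmoothEmbedding (𝓡 4) (𝓡 4) ∞ e → (Literature.Geometry.Kaehler.IsSmoothForm Ω ∧ Literature.Geometry.Kaehler.IsClosedForm Ω ∧ ∀ x (v : TangentSpace (𝓡 4) x), v ≠ 0 → ∃ w, Ω x ![v, w] ≠ 0) → (∃ U : Set S.carrier, IsOpen U ∧ (e '' Metric.ball (0 : EuclideanSpace ℝ (Fin 4)) 1)ᶜ ⊆ U ∧ ContMDiffOn (𝓡 4) (𝓡 4) ∞ J U ∧ Set.InjOn J U ∧ ∀ x ∈ U, Function.Bijective (mfderiv (𝓡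 4) (𝓡 4) J x)) → ((∃ c c' : (Metric.sphere (0 : EuclideanSpace ℝ (Fin 3)) 1) → X, (Manifold.IsSmoothEmbedding (𝓡 2) (𝓡 4) ∞ c ∧ (∀ y (v : TangentSpace (𝓡 2) y), v ≠ 0 → ∃ w : TangentSpace (𝓡 2) y, Ω (c y) ![mfderiv (𝓡 2) (𝓡 4) c y v, mfderiv (𝓡 2) (𝓡 4) c y w] ≠ 0) ∧ Manifold.IsSmoothEmbedding (𝓡 2) (𝓡 4) ∞ c' ∧ Disjoint (Set.range c) (Set.range c') ∧ ∃ H : unitInterval × (Metric.sphere (0 : EuclideanSpace ℝ (Fin 3)) 1) → X, Continuous H ∧ ∀ y, H (0, y) = c y ∧ H (1, y) = c' y)) ∨ (∃ (Ψ : X ≃ₘ⟮𝓡 4, 𝓡 4⟯ Literature.Topology.FourManifolds.ComplexProjectivePlane) (a : ℝ), 0 < a ∧ ∀ x (v w : TangentSpace (𝓡 4) x), Ω x ![v, w] = a * Literature.Geometry.Kaehler.CPn.fsForm 2 (Ψ x) ![mfderiv (𝓡 4) (𝓡 4) Ψ x v, mfderiv (𝓡 4) (𝓡 4) Ψ x w]))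 → ∃ (J' : S.carrier → X) (θ : EuclideanSpace ℝ (Fin 4) → EuclideanSpace ℝ (Fin 4) →L[ℝ] ℝ), (∃ U : Set S.carrier, IsOpen U ∧ (e '' Metric.ball (0 : EuclideanSpace ℝ (Fin 4)) 1)ᶜ ⊆ U ∧ ContMDiffOn (𝓡 4) (𝓡 4) ∞ J' U ∧ Set.InjOn J' U ∧ ∀ x ∈ U, Function.Bijective (mfderiv (𝓡 4) (𝓡 4) J' x)) ∧ (ContDiff ℝ ∞ θ ∧ (∀ u : EuclideanSpace ℝ (Fin 4), ‖u‖ = 1 → ∀ v : Fin 3 → EuclideanSpace ℝ (Fin 4), (∀ i, ⟪v i, u⟫ = 0) → LinearIndependent ℝ v → θ u (v 0) * Ω ((J' ∘ e) u) ![mfderiv (𝓡 4) (𝓡 4) (J' ∘ e) u (v 1), mfderiv (𝓡 4) (𝓡 4) (J' ∘ e) u (v 2)] - θ u (v 1) * Ω ((J' ∘ e) u) ![mfderiv (𝓡 4) (𝓡 4) (J' ∘ e) u (v 0), mfderiv (𝓡 4) (𝓡 4) (J' ∘ e) u (v 2)] + θ u (v 2) * Ω ((J' ∘ e) u) ![mfderiv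 (𝓡 4) (𝓡 4) (J' ∘ e) u (v 0), mfderiv (𝓡 4) (𝓡 4) (J' ∘ e) u (v 1)] ≠ 0) ∧ (∀ u : EuclideanSpace ℝ (Fin 4), ‖u‖ = 1 → ∀ v : EuclideanSpace ℝ (Fin 4), ⟪v, u⟫ = 0 → (∀ w : EuclideanSpace ℝ (Fin 4), ⟪w, u⟫ = 0 → Ω ((J' ∘ e) u) ![mfderiv (𝓡 4) (𝓡 4) (J' ∘ e) u v, mfderiv (𝓡 4) (𝓡 4) (J' ∘ e) u w] = 0) → ∀ w : EuclideanSpace ℝ (Fin 4), ⟪w, u⟫ = 0 → fderiv ℝ θ u v w - fderiv ℝ θ u w v = 0)) := by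
  sorry

/-- TRANSPORT 1 [RE-EMBEDDING ALONG A HOST DIFFEOMORPHISM `X ≅ Y`] (formal, M-sized: `mfderiv`
chain rule with a diffeomorphism, injectivity of a composite, the same open `U`).  Used twice:
with `Y = X` (SR's `φ`) in the composition, and with `P ≅ ℂℙ²` in the Gluck-twist instance of
STUB 1.  Sources: folklore (cf. `Negative.foldData_transport`, p72874). -/
theorem stub_reembedAlongDiffeo :
    ∀ (S : Literature.Topology.FourManifolds.HomotopySphere 4) (e : EuclideanSpace ℝ (Fin 4) → S.carrier) (X : Type) [TopologicalSpace X] [ChartedSpace (EuclideanSpace ℝ (Fin 4)) X] [IsManifold (𝓡 4) ∞ X] (Y : Type) [TopologicalSpace Y] [ChartedSpace (EuclideanSpace ℝ (Fin 4)) Y] [IsManifold (𝓡 4) ∞ Y] (J : S.carrier → X) (φ : X ≃ₘ⟮𝓡 4, 𝓡 4⟯ Y), (∃ U : Set S.carrier, IsOpen U ∧ (e '' Metric.ball (0 : EuclideanSpace ℝ (Fin 4)) 1)ᶜ ⊆ U ∧ ContMDiffOn (𝓡 4) (𝓡 4) ∞ J U ∧ Set.InjOn J U ∧ ∀ x ∈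 U, Function.Bijective (mfderiv (𝓡 4) (𝓡 4) J x)) → (∃ U : Set S.carrier, IsOpen U ∧ (e '' Metric.ball (0 : EuclideanSpace ℝ (Fin 4)) 1)ᶜ ⊆ U ∧ ContMDiffOn (𝓡 4) (𝓡 4) ∞ (φ ∘ J) U ∧ Set.InjOn (φ ∘ J) U ∧ ∀ x ∈ U, Function.Bijective (mfderiv (𝓡 4) (𝓡 4) (φ ∘ J) x)) :=
  -- LANDED (wave 1, worker A, p154047): `Theorems/SymplecticOrigamiOrigamiFoldExistenceStubReembedAlongDiffeo.lean`
  Summit.SmoothPoincare4.SmoothPoincare4.Theorems.OrigamiFoldExistence.StableSeamHost.stub_reembedAlongDiffeo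

/-- TRANSPORT 2 [THE SEAM IS A SHELL EMBEDDING] (formal, M-sized: `J ∘ e` is `C^∞`, injective and
immersive on the open `e ⁻¹' U ⊇ S³`, by the chain rule and `Manifold.IsSmoothEmbedding e`).
Sources: folklore. -/
theorem stub_seamShell :
    ∀ (S : Literature.Topology.FourManifolds.HomotopySphere 4) (e : EuclideanSpace ℝ (Fin 4) → S.carrier) (X : Type) [TopologicalSpace X] [ChartedSpace (EuclideanSpace ℝ (Fin 4)) X] [IsManifold (𝓡 4) ∞ X] (J : S.carrier → X), Manifold.IsSmoothEmbedding (𝓡 4) (𝓡 4) ∞ e → (∃ U : Set S.carrier, IsOpen U ∧ (e '' Metric.ball (0 : EuclideanSpace ℝ (Fin 4)) 1)ᶜ ⊆ U ∧ ContMDiffOn (𝓡 4) (𝓡 4) ∞ J U ∧ Set.InjOn J U ∧ ∀ x ∈ U, Function.Bijective (mfderiv (𝓡 4) (𝓡 4) J x)) → (∃ V : Set (EuclideanSpace ℝ (Fin 4)), IsOpen V ∧ Metric.sphere (0 : EuclideanSpace ℝ (Fin 4)) 1 ⊆ V ∧ ContMDiffOn (𝓡 4) (𝓡 4) ∞ (J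 ∘ e) V ∧ Set.InjOn (J ∘ e) V ∧ ∀ u ∈ V, Function.Bijective (mfderiv (𝓡 4) (𝓡 4) (J ∘ e) u)) :=
  -- LANDED (wave 1, worker B, p154126): `Theorems/SymplecticOrigamiOrigamiFoldExistenceStubSeamShell.lean`
  Summit.SmoothPoincare4.SmoothPoincare4.Theorems.OrigamiFoldExistence.StableSeamHost.stub_seamShell

/-- STUB 3 v2 [STABLE-SEAM RIGIDITY — the HARDEST and load-bearing stub] (rigid: punctured
holomorphic curves; size XL; open).  "A stable 3-sphere in a closed simply connected rational
symplectic 4-manifold bounds a ball on its homologically trivial side": if the fake ball of the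
homotopy 4-sphere `S` sits (`J`) in a rational host (square-zero pair, or `ℂℙ²` with its lines)
with `Ω`-STABLE seam (`θ`), then `S ≅ S⁴` (the piece `J(Δ_e)` is contractible with `S³`
boundary, simply connected by van Kampen in the simply connected host; `J(Δ_e) ≅ B⁴` is the
claim; Cerf `Γ₄ = 0` consumed inside).  Engine: SFT compactness along the stable seam (BEHWZ 2003;
CV 2015 Thm 1.11), the host's GW-spheres / lines through points deep inside `J(Δ_e)` (McDuff
1990, Gromov 1985), automatic transversality in dimension 4 (Wendl 2010), recognition of a
`b₂ = 0` filling swept by finite-energy planes as a ball — the argument of the KNOWN RUNG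
(contact-type seam: Gromov 1985, Eliashberg 1990 Thm 5.1, McDuff 1990 Thm 1.7) with "contact"
weakened to "stable"; residue FEF + T7-SHS (CALIBRATION-c8 §0, c9 §3).  BENCH: the
Cieliebak–Volkov exotic ball (CV 2015 Prop 7.15 / Cor 7.17) — no proof can live on the trace or
conclude symplectic standardness; it must be a DIFFEOMORPHISM recogniser reading `b₂ = 0`,
`π₁ = 1` off the filling (Disproof §1.6/§9.3).  Why it might fail: unprovable rather than false
(shielded: a counterexample is an exotic `S⁴`).  Sources: arXiv:1003.5084, BEHWZ2003, McDuff1990,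
McDuff1991, Eliashberg1990, Gromov1985, Wendl2010, HutchingsTaubes2009, Cerf1968. -/
theorem stub_stableSeamRigidity :
    ∀ (S : Literature.Topology.FourManifolds.HomotopySphere 4) (e : EuclideanSpace ℝ (Fin 4) → S.carrier) (X : Type) [TopologicalSpace X] [T2Space X] [SecondCountableTopology X] [CompactSpace X] [ChartedSpace (EuclideanSpace ℝ (Fin 4)) X] [IsManifold (𝓡 4) ∞ X] [SimplyConnectedSpace X] (Ω : Literature.Geometry.Kaehler.MForm (𝓡 4) X ℝ 2) (J : S.carrier → X) (θ : EuclideanSpace ℝ (Fin 4) → EuclideanSpace ℝ (Fin 4) →L[ℝ] ℝ), Manifold.IsSmoothEmbedding (𝓡 4) (𝓡 4) ∞ e → (Literature.Geometry.Kaehler.IsSmoothForm Ω ∧ Literature.Geometry.Kaehler.IsClosedForm Ω ∧ ∀ x (v : TangentSpace (𝓡 4) x), v ≠ 0 → ∃ w, Ω x ![v, w] ≠ 0) → (∃ U : Set S.carrier, IsOpen U ∧ (e '' Metric.ball (0 : EuclideanSpace ℝ (Fin 4)) 1)ᶜ ⊆ U ∧ ContMDiffOn (𝓡 4) (𝓡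 4) ∞ J U ∧ Set.InjOn J U ∧ ∀ x ∈ U, Function.Bijective (mfderiv (𝓡 4) (𝓡 4) J x)) → ((∃ c c' : (Metric.sphere (0 : EuclideanSpace ℝ (Fin 3)) 1) → X, (Manifold.IsSmoothEmbedding (𝓡 2) (𝓡 4) ∞ c ∧ (∀ y (v : TangentSpace (𝓡 2) y), v ≠ 0 → ∃ w : TangentSpace (𝓡 2) y, Ω (c y) ![mfderiv (𝓡 2) (𝓡 4) c y v, mfderiv (𝓡 2) (𝓡 4) c y w] ≠ 0) ∧ Manifold.IsSmoothEmbedding (𝓡 2) (𝓡 4) ∞ c' ∧ Disjoint (Set.range c) (Set.range c') ∧ ∃ H : unitInterval × (Metric.sphere (0 : EuclideanSpace ℝ (Fin 3)) 1) → X, Continuous H ∧ ∀ y, H (0, y) = c y ∧ H (1, y) = c' y)) ∨ (∃ (Ψ : X ≃ₘ⟮𝓡 4, 𝓡 4⟯ Literature.Topology.FourManifolds.ComplexProjectivePlane) (a : ℝ), 0 < a ∧ ∀ x (v w : TangentSpace (𝓡 4) x), Ω x ![v, w] = a * Literature.Geometry.Kaehler.CPn.fsForm 2 (Ψ x) ![mfderiv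 (𝓡 4) (𝓡 4) Ψ x v, mfderiv (𝓡 4) (𝓡 4) Ψ x w])) → (ContDiff ℝ ∞ θ ∧ (∀ u : EuclideanSpace ℝ (Fin 4), ‖u‖ = 1 → ∀ v : Fin 3 → EuclideanSpace ℝ (Fin 4), (∀ i, ⟪v i, u⟫ = 0) → LinearIndependent ℝ v → θ u (v 0) * Ω ((J ∘ e) u) ![mfderiv (𝓡 4) (𝓡 4) (J ∘ e) u (v 1), mfderiv (𝓡 4) (𝓡 4) (J ∘ e) u (v 2)] - θ u (v 1) * Ω ((J ∘ e) u) ![mfderiv (𝓡 4) (𝓡 4) (J ∘ e) u (v 0), mfderiv (𝓡 4) (𝓡 4) (J ∘ e) u (v 2)] + θ u (v 2) * Ω ((J ∘ e) u) ![mfderiv (𝓡 4) (𝓡 4) (J ∘ e) u (v 0), mfderiv (𝓡 4) (𝓡 4) (J ∘ e) u (v 1)] ≠ 0) ∧ (∀ u : EuclideanSpace ℝ (Fin 4), ‖u‖ = 1 → ∀ v : EuclideanSpace ℝ (Fin 4), ⟪v, u⟫ = 0 → (∀ w : EuclideanSpace ℝ (Fin 4), ⟪w, u⟫ = 0 → Ω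 ((J ∘ e) u) ![mfderiv (𝓡 4) (𝓡 4) (J ∘ e) u v, mfderiv (𝓡 4) (𝓡 4) (J ∘ e) u w] = 0) → ∀ w : EuclideanSpace ℝ (Fin 4), ⟪w, u⟫ = 0 → fderiv ℝ θ u v w - fderiv ℝ θ u w v = 0)) → Nonempty (S.carrier ≃ₘ⟮𝓡 4, 𝓡 4⟯ Metric.sphere (0 : EuclideanSpace ℝ (Fin 5)) 1) := by
  sorry

/-! ### Consistency: each named statement IS its registered stub (definitionally) -/

theorem hostEmbedding_holds : HostEmbedding := stub_hostEmbedding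
theorem stableSeam_holds : StableSeam := stub_stableSeam
theorem reembedAlongDiffeo_holds : ReembedAlongDiffeo := stub_reembedAlongDiffeo
theorem seamShell_holds : SeamShell := stub_seamShell
theorem stableSeamRigidity_holds : StableSeamRigidity := stub_stableSeamRigidity

/-- The transport statement is PROVED (`Negative.foldData_transport`, p72874). -/
theorem foldDataTransport_holds : FoldDataTransport := fun _ _ _ _ _ _ _ _ _ _ _ _ ⟨Φ⟩ h =>
  Summit.SmoothPoincare4.SmoothPoincare4.Theorems.OrigamiFoldExistence.Negative.foldData_transport Φ h

/-! ### Name-keyed aliases of the five statements (the hypotheses of the composition) -/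

namespace Registered

/-- Alias: STUB 1 v2. -/
abbrev stub_hostEmbedding : Prop := HostEmbedding
/-- Alias: STUB 2 v3 (SR-as-used). -/
abbrev stub_stableSeam : Prop := StableSeam
/-- Alias: transport 1. -/
abbrev stub_reembedAlongDiffeo : Prop := ReembedAlongDiffeo
/-- Alias: transport 2. -/
abbrev stub_seamShell : Prop := SeamShell
/-- Alias: STUB 3 v2. -/
abbrev stub_stableSeamRigidity : Prop := StableSeamRigidity

end Registered

/-! ### Glue (proved) -/

/-- STUB 2 DERIVED: SR applied to the seam `g := J ∘ e` (a shell embedding by transport 2), then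
`J' := φ ∘ J` (a fake-ball-neighbourhood embedding by transport 1); the two spellings
`(φ ∘ J) ∘ e` and `φ ∘ (J ∘ e)` of its seam agree definitionally. -/
theorem stableSeam_of (hSR : StableRepresentative) (hT : ReembedAlongDiffeo) (hSh : SeamShell) :
    StableSeam := by
  intro S e X _ _ _ _ _ _ _ Ω J he hΩ hJ hX
  obtain ⟨φ, θ, hθ⟩ := hSR X Ω (J ∘ e) hΩ hX (hSh S e X J he hJ)
  exact ⟨φ ∘ J, θ, hT S e X X J φ hJ, hθ⟩

/-- HOST ⟶ STABLE SEAM ⟶ RIGIDITY: `S ≅ S⁴` for every `S : HomotopySphere 4` (the chart ball `e`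
comes from the LANDED `stub_chartEmbedding`, p87331). -/
theorem nonempty_diffeomorph_sphere_of (h1 : HostEmbedding) (h2 : StableSeam)
    (h3 : StableSeamRigidity) (S : HomotopySphere 4) : Nonempty (S.carrier ≃ₘ⟮𝓡 4, 𝓡 4⟯ 𝕊⁴) := by
  obtain ⟨e, he⟩ :=
    Summit.SmoothPoincare4.SmoothPoincare4.Theorems.OrigamiFoldExistence.RoundTraceContinuity.stub_chartEmbedding S
  obtain ⟨X, _, _, _, _, _, _, _, Ω, J, hΩ, hJ, hX⟩ := h1 S e he
  obtain ⟨J', θ, hJ', hθ⟩ := h2 S e X Ω J he hΩ hJ hX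
  exact h3 S e X Ω J' θ he hΩ hJ' hX hθ

/-- The same from SR in place of the stable-seam stub (transport LANDED and discharged). -/
theorem nonempty_diffeomorph_sphere_of_stableRepresentative (h1 : HostEmbedding)
    (hSR : StableRepresentative) (h3 : StableSeamRigidity) (S : HomotopySphere 4) :
    Nonempty (S.carrier ≃ₘ⟮𝓡 4, 𝓡 4⟯ 𝕊⁴) :=
  nonempty_diffeomorph_sphere_of h1 (stableSeam_of hSR reembedAlongDiffeo_holds seamShell_holds) h3 S

/-- The same at a SINGLE homotopy sphere whose STUB-1 conclusion is known (e.g. a Gluck twist, by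
`helper_hostEmbedding_of_isGluckTwist`): SR ∧ transport ∧ STUB 3 standardise it. -/
theorem nonempty_diffeomorph_sphere_of_hostEmbeddingAt (hSR : StableRepresentative)
    (hT : ReembedAlongDiffeo) (hSh : SeamShell) (h3 : StableSeamRigidity) (S : HomotopySphere 4)
    (h1S : ∀ e : E4 → S.carrier, Manifold.IsSmoothEmbedding (𝓡 4) (𝓡 4) ∞ e →
      ∃ (X : Type) (_ : TopologicalSpace X) (_ : T2Space X) (_ : SecondCountableTopology X)
        (_ : CompactSpace X) (_ : ChartedSpace E4 X) (_ : IsManifold (𝓡 4) ∞ X)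
        (_ : SimplyConnectedSpace X) (Ω : Literature.Geometry.Kaehler.MForm (𝓡 4) X ℝ 2)
        (J : S.carrier → X), IsSymplecticForm X Ω ∧ EmbedsFakeBallNhd S e X J ∧ IsRationalHost X Ω) :
    Nonempty (S.carrier ≃ₘ⟮𝓡 4, 𝓡 4⟯ 𝕊⁴) := by
  obtain ⟨e, he⟩ :=
    Summit.SmoothPoincare4.SmoothPoincare4.Theorems.OrigamiFoldExistence.RoundTraceContinuity.stub_chartEmbedding S
  obtain ⟨X, _, _, _, _, _, _, _, Ω, J, hΩ, hJ, hX⟩ := h1S e he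
  obtain ⟨J', θ, hJ', hθ⟩ := stableSeam_of hSR hT hSh S e X Ω J he hΩ hJ hX
  exact h3 S e X Ω J' θ he hΩ hJ' hX hθ

/-! ### The Gluck-twist instance (LANDED, lead c10, p154231) -/

/-- STUB 1 v2 HOLDS FOR EVERY GLUCK TWIST (landed `helper_hostEmbedding_of_isGluckTwist`, via the
tree's discharged `gluckTwist_connectedSum_complexProjectivePlane_holds` and the `ℂℙ²` disjunct of
`IsRationalHost`): recorded here at the skeleton's vocabulary. -/
theorem hostEmbedding_of_isGluckTwist (K : TwoKnot) (S : HomotopySphere 4)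
    (hK : IsGluckTwist (𝓡 4) S.carrier K) (e : E4 → S.carrier)
    (he : Manifold.IsSmoothEmbedding (𝓡 4) (𝓡 4) ∞ e) :
    ∃ (X : Type) (_ : TopologicalSpace X) (_ : T2Space X) (_ : SecondCountableTopology X)
      (_ : CompactSpace X) (_ : ChartedSpace E4 X) (_ : IsManifold (𝓡 4) ∞ X)
      (_ : SimplyConnectedSpace X) (Ω : Literature.Geometry.Kaehler.MForm (𝓡 4) X ℝ 2)
      (J : S.carrier → X), IsSymplecticForm X Ω ∧ EmbedsFakeBallNhd S e X J ∧ IsRationalHost X Ω :=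
  Summit.SmoothPoincare4.SmoothPoincare4.Theorems.OrigamiFoldExistence.StableSeamHost.helper_hostEmbedding_of_isGluckTwist
    K S e hK he

/-- THE GLUCK PROBLEM REDUCED TO STABLE 3-SPHERES IN RATIONAL SURFACES (landed rider
`helper_gluckTwist_diffeomorph_sphere_of_stableSpheres`, p154231, with the two transport stubs
DISCHARGED by their landed proofs p154047/p154126): the two research-open stubs of this line —
SR and stable-seam rigidity — imply that every Gluck twist `Σ_K` is diffeomorphic to `S⁴`
(Kirby Problem 4.24 for Gluck twists), with no dissolution hypothesis left. -/
theorem gluckTwist_standard_of (hSR : StableRepresentative) (h3 : StableSeamRigidity)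
    (K : TwoKnot) (X : Type) [TopologicalSpace X] [T2Space X] [SecondCountableTopology X]
    [ChartedSpace E4 X] [IsManifold (𝓡 4) ∞ X] (hX : IsGluckTwist (𝓡 4) X K) :
    Nonempty (X ≃ₘ⟮𝓡 4, 𝓡 4⟯ 𝕊⁴) :=
  Summit.SmoothPoincare4.SmoothPoincare4.Theorems.OrigamiFoldExistence.StableSeamHost.helper_gluckTwist_diffeomorph_sphere_of_stableSpheres
    hSR stub_reembedAlongDiffeo stub_seamShell h3 K X hX

/-- CROSS-ROUTE LINKS (LANDED, lead c10, p154658): route `DissolvableGluck`'s crux `DissolveOne`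
(stmt-SmoothPoincare4-17710: every homotopy 4-sphere dissolves in one `ℂℙ²`) implies STUB 1 v2
verbatim — so STUB 1 v2 sits formally below BOTH staffed dissolution cruxes of the summit
(`Stabilisation.StabOneSuffices`, stmt-0386, and `DissolvableGluck.DissolveOne`, stmt-17710). -/
theorem hostEmbedding_of_dissolveOne
    (hD : Summit.SmoothPoincare4.SmoothPoincare4.Theses.DissolvableGluck.DissolveOne) : HostEmbedding :=
  Summit.SmoothPoincare4.SmoothPoincare4.Theorems.OrigamiFoldExistence.StableSeamHost.helper_hostEmbeddingV2_of_dissolveOne hD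

/-- SR ∧ stable-seam rigidity ⇒ route `DissolvableGluck`'s crux `GluckTwistsStandard`
(stmt-SmoothPoincare4-17711) BY NAME (landed `helper_gluckTwistsStandard_of_stableSpheres`, p154658). -/
theorem gluckTwistsStandard_of (hSR : StableRepresentative) (h3 : StableSeamRigidity) :
    Summit.SmoothPoincare4.SmoothPoincare4.Theses.DissolvableGluck.GluckTwistsStandard :=
  Summit.SmoothPoincare4.SmoothPoincare4.Theorems.OrigamiFoldExistence.StableSeamHost.helper_gluckTwistsStandard_of_stableSpheres
    hSR h3

/-- SR ∧ stable-seam rigidity ⇒ route `DissolvableGluck`'s TARGET `CP2CancellationOne`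
(stmt-SmoothPoincare4-17708: every `ℂℙ²`-dissolvable homotopy 4-sphere is `S⁴`) BY NAME (landed
`helper_cp2CancellationOne_of_stableSpheres`, p154658) — no dissolution hypothesis, no DIG. -/
theorem cp2CancellationOne_of (hSR : StableRepresentative) (h3 : StableSeamRigidity) :
    Summit.SmoothPoincare4.SmoothPoincare4.Theses.DissolvableGluck.CP2CancellationOne :=
  Summit.SmoothPoincare4.SmoothPoincare4.Theorems.OrigamiFoldExistence.StableSeamHost.helper_cp2CancellationOne_of_stableSpheres
    hSR h3

/-- SR's KNOWN RUNG (LANDED, lead c10 cycle 2, p157795): in any symplectic `ℝ⁴`-charted connected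
`(X, Ω)` — in particular in every rational host — the conclusion of `StableRepresentative` holds for
every shell map that extends to a DISC (smooth embedding of the model space): some self-diffeomorphism
carries the 3-sphere it bounds to an Ω-stable (indeed contact-type) one. -/
theorem stableRepresentative_of_disc (X : Type) [TopologicalSpace X] [T2Space X] [ConnectedSpace X]
    [ChartedSpace E4 X] [IsManifold (𝓡 4) ∞ X] (Ω : Literature.Geometry.Kaehler.MForm (𝓡 4) X ℝ 2)
    (G : E4 → X) (hΩ : IsSymplecticForm X Ω) (hG : Manifold.IsSmoothEmbedding (𝓡 4) (𝓡 4) ∞ G) :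
    ∃ (φ : X ≃ₘ⟮𝓡 4, 𝓡 4⟯ X) (θ : E4 → E4 →L[ℝ] ℝ), IsStabilising (shellTrace X Ω (φ ∘ G)) θ :=
  Summit.SmoothPoincare4.SmoothPoincare4.Theorems.OrigamiFoldExistence.StableSeamHost.helper_stableRepresentative_of_disc
    X Ω G hΩ hG

/-- NON-VACUITY of STUB 3's hypotheses (LANDED, wave 1 worker E, p157433): the full hypothesis package
of `stub_stableSeamRigidity` (chart ball, symplectic rational host, fake-ball-neighbourhood embedding,
stabilised seam) is inhabited at `S = S⁴` in the host `S² × S²`. -/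
example : ∃ (S : HomotopySphere 4) (e : E4 → S.carrier) (X : Type) (_ : TopologicalSpace X) (_ : T2Space X)
    (_ : SecondCountableTopology X) (_ : CompactSpace X) (_ : ChartedSpace E4 X) (_ : IsManifold (𝓡 4) ∞ X)
    (_ : SimplyConnectedSpace X) (Ω : Literature.Geometry.Kaehler.MForm (𝓡 4) X ℝ 2) (J : S.carrier → X)
    (θ : E4 → E4 →L[ℝ] ℝ), Nonempty (S.carrier ≃ₘ⟮𝓡 4, 𝓡 4⟯ 𝕊⁴) ∧ Manifold.IsSmoothEmbedding (𝓡 4) (𝓡 4) ∞ e ∧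
      IsSymplecticForm X Ω ∧ EmbedsFakeBallNhd S e X J ∧ IsRationalHost X Ω ∧ IsStabilising (seamTrace S e X Ω J) θ :=
  Summit.SmoothPoincare4.SmoothPoincare4.Theorems.OrigamiFoldExistence.StableSeamHost.helper_stableSeamHypotheses_inhabited

/-- KERNEL TWIN of the SR variant of the composition (landed rider
`helper_origamiFoldExistence_of_stableSeamHostV2`, p154209): STUB 1, SR, the two (landed) transport
stubs and STUB 3 imply the crux BY NAME inside the importable tree.  (The v3 twin
`helper_origamiFoldExistence_of_stableSeamHostV3 : STUB 1 → StableSeam → STUB 3 → E` lands with the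
lead's cycle-1 file.) -/
example (hSR : StableRepresentative) : OrigamiFoldExistence :=
  Summit.SmoothPoincare4.SmoothPoincare4.Theorems.OrigamiFoldExistence.StableSeamHost.helper_origamiFoldExistence_of_stableSeamHostV2
    stub_hostEmbedding hSR stub_reembedAlongDiffeo stub_seamShell stub_stableSeamRigidity

/-! ### Shields and exactness of registry v3 (all LANDED) -/

/-- SHIELD of STUB 1 v2 (p154209): SPC4 ⇒ `HostEmbedding`. -/
example (hS : _root_.SmoothPoincare4) : HostEmbedding :=
  Summit.SmoothPoincare4.SmoothPoincare4.Theorems.OrigamiFoldExistence.StableSeamHost.helper_hostEmbeddingV2_of_smoothPoincare4 hS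

/-- SHIELD of STUB 2 v3 (lead c11, p162106): SPC4 ⇒ `StableSeam` — a fake ball that is a ball bounds
a disc WITH THE BOUNDARY VALUES OF `e` (Palais, transported), discs have contact-type
representatives (p157795), and the stability clauses transfer along the sphere agreement. -/
example (hS : _root_.SmoothPoincare4) : StableSeam :=
  Summit.SmoothPoincare4.SmoothPoincare4.Theorems.OrigamiFoldExistence.StableSeamHost.helper_stableSeamV2_of_smoothPoincare4 hS

/-- SHIELD of STUB 3 v2 (p154209): SPC4 ⇒ `StableSeamRigidity`. -/
example (hS : _root_.SmoothPoincare4) : StableSeamRigidity :=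
  Summit.SmoothPoincare4.SmoothPoincare4.Theorems.OrigamiFoldExistence.StableSeamHost.helper_stableSeamRigidityV2_of_smoothPoincare4 hS

/-- EXACTNESS (lead c11, p162106): `SmoothPoincare4 ⟺ HostEmbedding ∧ StableSeam ∧ StableSeamRigidity`
— registry v3 is an exact three-way split of the crux. -/
example : _root_.SmoothPoincare4 ↔ (HostEmbedding ∧ StableSeam ∧ StableSeamRigidity) :=
  Summit.SmoothPoincare4.SmoothPoincare4.Theorems.OrigamiFoldExistence.StableSeamHost.helper_smoothPoincare4_iff_stableSeamHostV3

/-- KERNEL TWIN of the v3 composition (lead c11, p162106; the `--glue-by` of the split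
`E ⇐ HostEmbedding ∧ StableSeam ∧ StableSeamRigidity`): the three v3 stubs imply the crux BY NAME
inside the importable tree. -/
example : OrigamiFoldExistence :=
  Summit.SmoothPoincare4.SmoothPoincare4.Theorems.OrigamiFoldExistence.StableSeamHost.helper_origamiFoldExistence_of_stableSeamHostV3
    stub_hostEmbedding stub_stableSeam stub_stableSeamRigidity

/-! ### The ROUND-SEAM RUNG of STUB 3 (lead c11 cycle 2, LANDED p163844): ⇐ `GromovRecognitionRelEnd` (stmt-11009) -/

/-- THE ROUND RUNG OF THE LINE: `GromovRecognitionRelEnd → HostEmbedding → RoundSeam → SmoothPoincare4`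
— the bottom rung of the ladder round ⊂ contact ⊂ stable for STUB 3, kernel-reduced to the route's
filed support item stmt-SmoothPoincare4-11009 (Gromov's recognition of `(ℝ⁴, ω₀)` relative to a
standard end; McDuff–Salamon 2017 Rem. 4.5.2 (viii)). -/
example (hG : Summit.SmoothPoincare4.SmoothPoincare4.Theses.SymplecticOrigami.GromovRecognitionRelEnd)
    (h1 : HostEmbedding) (h2 : RoundSeam) : _root_.SmoothPoincare4 :=
  Summit.SmoothPoincare4.SmoothPoincare4.Theorems.OrigamiFoldExistence.StableSeamHost.helper_smoothPoincare4_of_hostEmbedding_roundSeam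
    hG h1 h2

/-- Hence (with the LANDED shields) the round rung also feeds the crux BY NAME: `GromovRecognitionRelEnd →
HostEmbedding → RoundSeam → OrigamiFoldExistence`. -/
example (hG : Summit.SmoothPoincare4.SmoothPoincare4.Theses.SymplecticOrigami.GromovRecognitionRelEnd)
    (h1 : HostEmbedding) (h2 : RoundSeam) : OrigamiFoldExistence :=
  Summit.SmoothPoincare4.SmoothPoincare4.Theorems.OrigamiFoldExistence.Negative.origamiFoldExistence_of_smoothPoincare4
    (Summit.SmoothPoincare4.SmoothPoincare4.Theorems.OrigamiFoldExistence.StableSeamHost.helper_smoothPoincare4_of_hostEmbedding_roundSeam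
      hG h1 h2)
    Summit.SmoothPoincare4.SmoothPoincare4.Theorems.roundSphereIsOrigamiFold_proof

/-- NON-VACUITY of the round rung (brick R0, p163435): chart ball, symplectic rational host, fake-ball
neighbourhood embedding AND a ROUND seam germ are jointly inhabited at `S = S⁴` in the host `S² × S²`
(antipodal stereographic transition `4L ∘ ι`, Darboux polydisc) — so `RoundSeam`'s hypotheses and
conclusion pattern are satisfiable exactly as typed. -/
example : ∃ (S : HomotopySphere 4) (e : E4 → S.carrier) (X : Type) (_ : TopologicalSpace X) (_ : T2Space X)
    (_ : SecondCountableTopology X) (_ : CompactSpace X) (_ : ChartedSpace E4 X) (_ : IsManifold (𝓡 4) ∞ X)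
    (_ : SimplyConnectedSpace X) (Ω : Literature.Geometry.Kaehler.MForm (𝓡 4) X ℝ 2) (J : S.carrier → X)
    (κ : ℝ) (A : E4 ≃ₗᵢ[ℝ] E4) (δ : ℝ), Nonempty (S.carrier ≃ₘ⟮𝓡 4, 𝓡 4⟯ 𝕊⁴) ∧
      Manifold.IsSmoothEmbedding (𝓡 4) (𝓡 4) ∞ e ∧ IsSymplecticForm X Ω ∧ EmbedsFakeBallNhd S e X J ∧
      IsRationalHost X Ω ∧ 0 < κ ∧ 0 < δ ∧ ∀ y : E4, 1 - δ < ‖y‖ → ‖y‖ < 1 + δ → ∀ v w : E4,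
        seamTrace S e X Ω J y v w = κ ^ 2 * Literature.Geometry.Symplectic.stdSymplecticForm
          (A (fderiv ℝ Literature.Geometry.Symplectic.inversion y v))
          (A (fderiv ℝ Literature.Geometry.Symplectic.inversion y w)) :=
  Summit.SmoothPoincare4.SmoothPoincare4.Theorems.OrigamiFoldExistence.StableSeamHost.helper_roundSeamHypotheses_inhabited

/-- ROUND ⊂ STABLE BY NAME (lead c11 cycle 3, LANDED p164763): the rung hypothesis `RoundSeam` implies the
registered STUB 2 `StableSeam` — a round seam trace is stabilised by the transported Liouville form. -/
example (h : RoundSeam) : StableSeam :=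
  Summit.SmoothPoincare4.SmoothPoincare4.Theorems.OrigamiFoldExistence.StableSeamHost.helper_stableSeam_of_roundSeam h

/-- Hence, under `GromovRecognitionRelEnd`, the ROUND case of the v3 composition closes end-to-end:
`HostEmbedding → RoundSeam → (StableSeam ∧ S ≅ S⁴ for every S)`. -/
example (hG : Summit.SmoothPoincare4.SmoothPoincare4.Theses.SymplecticOrigami.GromovRecognitionRelEnd)
    (h1 : HostEmbedding) (h2 : RoundSeam) : StableSeam ∧ _root_.SmoothPoincare4 :=
  ⟨Summit.SmoothPoincare4.SmoothPoincare4.Theorems.OrigamiFoldExistence.StableSeamHost.helper_stableSeam_of_roundSeam h2,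
    Summit.SmoothPoincare4.SmoothPoincare4.Theorems.OrigamiFoldExistence.StableSeamHost.helper_smoothPoincare4_of_hostEmbedding_roundSeam
      hG h1 h2⟩

/-- THE ROUND-SEAM RUNG WITH THE NATURAL ONE-SIDED GERM (lead c11 cycle 3, LANDED p164872): under
`GromovRecognitionRelEnd`, if the fake ball of `S` sits in a symplectic host with `J^*Ω` ROUND on the outer
collar `e({1 < ‖y‖ < 1 + δ})` (just inside the fake ball), then `S ≅ S⁴`. -/
example (hG : Summit.SmoothPoincare4.SmoothPoincare4.Theses.SymplecticOrigami.GromovRecognitionRelEnd)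
    (S : HomotopySphere 4) (e : E4 → S.carrier) (X : Type) [TopologicalSpace X] [T2Space X]
    [SecondCountableTopology X] [CompactSpace X] [ChartedSpace E4 X] [IsManifold (𝓡 4) ∞ X]
    [SimplyConnectedSpace X] (Ω : Literature.Geometry.Kaehler.MForm (𝓡 4) X ℝ 2) (J : S.carrier → X)
    (he : Manifold.IsSmoothEmbedding (𝓡 4) (𝓡 4) ∞ e) (hΩ : IsSymplecticForm X Ω)
    (hJ : EmbedsFakeBallNhd S e X J) (hX : IsRationalHost X Ω)
    (hround : ∃ (κ : ℝ) (A : E4 ≃ₗᵢ[ℝ] E4) (δ : ℝ), 0 < κ ∧ 0 < δ ∧ ∀ y : E4, 1 < ‖y‖ → ‖y‖ < 1 + δ →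
      ∀ v w : E4, seamTrace S e X Ω J y v w = κ ^ 2 * Literature.Geometry.Symplectic.stdSymplecticForm
        (A (fderiv ℝ Literature.Geometry.Symplectic.inversion y v))
        (A (fderiv ℝ Literature.Geometry.Symplectic.inversion y w))) :
    Nonempty (S.carrier ≃ₘ⟮𝓡 4, 𝓡 4⟯ 𝕊⁴) :=
  Summit.SmoothPoincare4.SmoothPoincare4.Theorems.OrigamiFoldExistence.StableSeamHost.helper_roundSeamRigidity_outer_of_gromovRecognitionRelEnd
    hG S e X Ω J he hΩ hJ hX hround

/-! ### The composition: the three OPEN v3 stubs and the route item `RoundSphereIsOrigamiFold`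
imply the crux, by name -/

/-- `OrigamiFoldExistence` from the registered stubs and the route item `RoundSphereIsOrigamiFold`
(stmt-7845, CLOSED), by name (pure logic + the PROVED packaging theorems; no `sorry`): a smooth
`M` with `M ≃ₕ S⁴` is compact and orientable, hence a `HomotopySphere 4`; the glue gives
`M ≅ S⁴`; transport the fold data of `S⁴`. -/
theorem OrigamiFoldExistence_of (h1 : Registered.stub_hostEmbedding)
    (h2 : Registered.stub_stableSeam) (h3 : Registered.stub_stableSeamRigidity)
    (hR : RoundSphereIsOrigamiFold) : OrigamiFoldExistence := by
  intro M _ _ _ _ _ hM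
  haveI : CompactSpace M :=
    Literature.Topology.FourManifolds.compactSpace_of_homotopyEquiv_sphere_four_holds M hM
  obtain ⟨o⟩ :=
    Literature.Topology.FourManifolds.isOrientable_of_homotopyEquiv_sphere_four_holds M hM
  have hφ : Nonempty (M ≃ₘ⟮𝓡 4, 𝓡 4⟯ 𝕊⁴) := nonempty_diffeomorph_sphere_of h1 h2 h3 ⟨M, o, ⟨hM⟩⟩
  exact foldDataTransport_holds M 𝕊⁴ hφ hR

/-- Wiring check: the registered OPEN stubs feed `OrigamiFoldExistence_of` as stated. -/
example (hR : RoundSphereIsOrigamiFold) : OrigamiFoldExistence :=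
  OrigamiFoldExistence_of stub_hostEmbedding stub_stableSeam stub_stableSeamRigidity hR

/-- Wiring check (SR variant): SR in place of the stable-seam stub also feeds the composition. -/
example (hSR : StableRepresentative) (hR : RoundSphereIsOrigamiFold) : OrigamiFoldExistence :=
  OrigamiFoldExistence_of stub_hostEmbedding (stableSeam_of hSR reembedAlongDiffeo_holds seamShell_holds)
    stub_stableSeamRigidity hR

/-- Sanity (the `S⁴`-instance of STUB 3 is trivially inhabited: the conclusion holds for the
round sphere itself). -/
example : Nonempty (𝕊⁴ ≃ₘ⟮𝓡 4, 𝓡 4⟯ 𝕊⁴) := ⟨Diffeomorph.refl _ _ _⟩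

/-- Sanity (the `ℂℙ²` disjunct of `IsRationalHost` is stated over objects the tree HAS: the type of
the Fubini–Study form of the `ℝ⁴`-charted projective plane is the host's `MForm` type). -/
example : Literature.Geometry.Kaehler.MForm (𝓡 4) ComplexProjectivePlane ℝ 2 :=
  Literature.Geometry.Kaehler.CPn.fsForm 2

end Summit.SmoothPoincare4.SmoothPoincare4.Cruxes.OrigamiFoldExistence.StableSeamHost

end
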